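import Literature.MathematicalPhysics.QuantumFieldTheory.TomboulisVortexDecimation
import HarnessLib

/-!
# Tomboulis's expansion of `Z - Z⁻` over the odd twisted sectors (App. A §5), every spin cut-off

E. T. Tomboulis, arXiv:0707.2179, App. A §5: with `S_p^{1/2} = Σ_{j half-integer} d_j c_j χ_j(U_p)` and
`S_p^1 = 1 + Σ_{j integer, j ≠ 0} d_j c_j χ_j(U_p)` (so that `f = S^1 + S^{1/2}` and the twisted
plaquette function is `f⁻ = S^1 - S^{1/2}`),
`∏_{p∈𝒱} [S_p^{1/2} + S_p^1] - ∏_{p∈𝒱} [-S_p^{1/2} + S_p^1] = 2 Σ_{Q ⊂ 𝒱, |Q| odd} ∏_{p∈Q} S_p^{1/2} ∏_{p∈𝒱∖Q} S_p^1`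
(eq. (A.17)), hence `Z - Z⁻ = 2 Σ_{Q ⊂ 𝒱, |Q| odd} ∫ ∏_{p∉𝒱} f(U_p) ∏_{p∈Q} S_p^{1/2} ∏_{p∈𝒱∖Q} S_p^1 ∏ dU`
(eq. (A.18)). This file states and proves (A.17)–(A.18) in the vocabulary of
`TomboulisVortexDecimation` (`plaqFn`, `plaqFnTwist`, `torusZ`, `torusZtw`; spins indexed by
`n = 2j`, so "half-integer" = odd `n`, "integer" = even `n`) for EVERY spin cut-off `J`, every
coefficient sequence, every twist set `V` and every torus `(ℤ/Lℤ)^d`, together with the companion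
expansion of `Z + Z⁻ = 2 Z⁺` over the even sectors. It is pure algebra plus linearity of the integral;
the positivity of each term ("manifestly non-negative by RP in `π`", which proves Prop. IV.1) is a
separate matter — see `OneCharacterTwistBound` for `J = 1`.

## Main statements

* `sHalf J c`, `sInt J c` — `S^{1/2}`, `S^1`; `plaqFn_eq_sInt_add_sHalf`, `plaqFnTwist_eq_sInt_sub_sHalf`.
* `tSector d L J c V Q` — the `Q`-term of (A.18).
* `torusZ_sub_torusZtw_eq_sum` — (A.18): `Z - Z⁻_V = 2 Σ_{Q ⊆ V, |Q| odd} tSector Q`;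
  `torusZ_add_torusZtw_eq_sum`: `Z + Z⁻_V = 2 Σ_{Q ⊆ V, |Q| even} tSector Q`.

## References

* E. T. Tomboulis, arXiv:0707.2179, App. A §5, eqs. (A.17)–(A.18)
  [cite: Tomboulis2007Confinement, App. A §5 eqs. (A.17)–(A.18)].
-/

noncomputable section

open MeasureTheory Finset
open scoped BigOperators
open Literature.MathematicalPhysics.QuantumLattice

namespace Literature.MathematicalPhysics.QuantumFieldTheory

namespace Tomboulis2007

/-! ### `S^{1/2}` and `S^1` -/

/-- `S_p^{1/2} = Σ_{j half-integer} d_j c_j χ_j(U_p)` — the half-integer-spin (odd `n = 2j`) part of the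
plaquette function (arXiv:0707.2179 App. A §5, display before eq. (A.17)).
[cite: Tomboulis2007Confinement, App. A §5 (display before eq. (A.17))] -/
def sHalf (J : ℕ) (c : ℕ → ℝ) (W : SU2) : ℝ :=
  ∑ n ∈ (Icc 1 J).filter (fun n => Odd n), ((n : ℝ) + 1) * c n * su2Char n W

/-- `S_p^1 = 1 + Σ_{j integer, j ≠ 0} d_j c_j χ_j(U_p)` — the integer-spin (even `n = 2j ≥ 2`) part
(arXiv:0707.2179 App. A §5, display before eq. (A.17)).
[cite: Tomboulis2007Confinement, App. A §5 (display before eq. (A.17))] -/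
def sInt (J : ℕ) (c : ℕ → ℝ) (W : SU2) : ℝ :=
  1 + ∑ n ∈ (Icc 1 J).filter (fun n => Even n), ((n : ℝ) + 1) * c n * su2Char n W

/-- The parity split of the spin range (plumbing). [folklore] -/
private theorem filter_not_even_eq (J : ℕ) :
    (Icc 1 J).filter (fun n => ¬ Even n) = (Icc 1 J).filter (fun n => Odd n) :=
  Finset.filter_congr fun _ _ => Nat.not_even_iff_odd

/-- `f = S^1 + S^{1/2}`. [cite: Tomboulis2007Confinement, App. A §5 eq. (A.17)] -/
theorem plaqFn_eq_sInt_add_sHalf (J : ℕ) (c : ℕ → ℝ) (W : SU2) :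
    plaqFn J c W = sInt J c W + sHalf J c W := by
  unfold plaqFn sInt sHalf
  rw [← Finset.sum_filter_add_sum_filter_not (Icc 1 J) (fun n => Even n), filter_not_even_eq, add_assoc]

/-- `f⁻ = S^1 - S^{1/2}`: the twist flips the half-integer spins.
[cite: Tomboulis2007Confinement, App. A §5 eq. (A.17)] -/
theorem plaqFnTwist_eq_sInt_sub_sHalf (J : ℕ) (c : ℕ → ℝ) (W : SU2) :
    plaqFnTwist J c W = sInt J c W - sHalf J c W := by
  unfold plaqFnTwist sInt sHalf
  rw [← Finset.sum_filter_add_sum_filter_not (Icc 1 J) (fun n => Even n), filter_not_even_eq]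
  have he : ∑ n ∈ (Icc 1 J).filter (fun n => Even n), (-1 : ℝ) ^ n * ((n : ℝ) + 1) * c n * su2Char n W =
      ∑ n ∈ (Icc 1 J).filter (fun n => Even n), ((n : ℝ) + 1) * c n * su2Char n W :=
    Finset.sum_congr rfl fun n hn => by rw [(Finset.mem_filter.1 hn).2.neg_one_pow, one_mul]
  have ho : ∑ n ∈ (Icc 1 J).filter (fun n => Odd n), (-1 : ℝ) ^ n * ((n : ℝ) + 1) * c n * su2Char n W =
      -∑ n ∈ (Icc 1 J).filter (fun n => Odd n), ((n : ℝ) + 1) * c n * su2Char n W := by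
    rw [← Finset.sum_neg_distrib]
    exact Finset.sum_congr rfl fun n hn => by rw [(Finset.mem_filter.1 hn).2.neg_one_pow]; ring
  rw [he, ho]
  ring

/-! ### Continuity and integrability (plumbing) -/

variable {d L : ℕ} [NeZero L]

omit [NeZero L] in
/-- `W ↦ Re tr W` is continuous on `SU(2)` (plumbing). [folklore] -/
private theorem continuous_reTrace :
    Continuous fun W : SU2 => ((W : Matrix (Fin 2) (Fin 2) ℂ).trace).re := by
  have h : ∀ i j : Fin 2, Continuous fun W : SU2 => (W : Matrix (Fin 2) (Fin 2) ℂ) i j := fun i j =>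
    (continuous_apply j).comp ((continuous_apply i).comp continuous_subtype_val)
  simp only [Matrix.trace_fin_two]
  exact Complex.continuous_re.comp ((h 0 0).add (h 1 1))

omit [NeZero L] in
/-- The characters are continuous (plumbing). [folklore] -/
private theorem continuous_su2Char (n : ℕ) : Continuous (su2Char n) := by
  unfold su2Char
  exact (Polynomial.continuous _).comp (continuous_reTrace.div_const 2)

omit [NeZero L] in
/-- `S^{1/2}` is continuous (plumbing). [folklore] -/
private theorem continuous_sHalf (J : ℕ) (c : ℕ → ℝ) : Continuous (sHalf J c) := by
  unfold sHalf
  exact continuous_finsetSum _ fun n _ => continuous_const.mul (continuous_su2Char n)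

omit [NeZero L] in
/-- `S^1` is continuous (plumbing). [folklore] -/
private theorem continuous_sInt (J : ℕ) (c : ℕ → ℝ) : Continuous (sInt J c) := by
  unfold sInt
  exact continuous_const.add (continuous_finsetSum _ fun n _ => continuous_const.mul (continuous_su2Char n))

omit [NeZero L] in
/-- `f` is continuous (plumbing). [folklore] -/
private theorem continuous_plaqFn (J : ℕ) (c : ℕ → ℝ) : Continuous (plaqFn J c) := by
  have h : plaqFn J c = fun W => sInt J c W + sHalf J c W := funext (plaqFn_eq_sInt_add_sHalf J c)
  rw [h]
  exact (continuous_sInt J c).add (continuous_sHalf J c)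

omit [NeZero L] in
/-- The plaquette holonomy depends continuously on the configuration (plumbing). [folklore] -/
private theorem continuous_hol (p : Plaquette d L) :
    Continuous fun U : GaugeConfig d L SU2 => plaquetteHolonomy U p.1 p.2.1.1 p.2.1.2 := by
  unfold plaquetteHolonomy
  fun_prop

/-- Continuous functions on `SU(2)^{links}` are Haar integrable (plumbing). [folklore] -/
private theorem integrable_of_continuous' {F : GaugeConfig d L SU2 → ℝ} (hF : Continuous F) :
    Integrable F (Measure.pi fun _ : Edge d L => haarProbability SU2) := by
  haveI : SecondCountableTopology (Matrix (Fin 2) (Fin 2) ℂ) :=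
    inferInstanceAs (SecondCountableTopology (Fin 2 → Fin 2 → ℂ))
  haveI : SecondCountableTopology SU2 := Topology.IsEmbedding.subtypeVal.secondCountableTopology
  exact hF.integrable_of_hasCompactSupport (HasCompactSupport.of_compactSpace F)

/-! ### The sector expansion -/

omit [NeZero L] in
/-- `∏_{p∈V}(b_p + a_p) - ∏_{p∈V}(b_p - a_p) = 2 Σ_{Q ⊆ V, |Q| odd} ∏_{p∈Q} a_p ∏_{p∈V∖Q} b_p`
(eq. (A.17) as an identity of commutative algebra) (plumbing). [folklore] -/
private theorem prod_add_sub_prod_sub (V : Finset (Plaquette d L)) (a b : Plaquette d L → ℝ) :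
    (∏ p ∈ V, (b p + a p)) - ∏ p ∈ V, (b p - a p) =
      2 * ∑ Q ∈ V.powerset.filter (fun Q => Odd Q.card), (∏ p ∈ Q, a p) * ∏ p ∈ V \ Q, b p := by
  have h1 : ∏ p ∈ V, (b p + a p) = ∑ Q ∈ V.powerset, (∏ p ∈ Q, a p) * ∏ p ∈ V \ Q, b p := by
    rw [Finset.prod_congr rfl fun p _ => add_comm (b p) (a p), Finset.prod_add]
  have h2 : ∏ p ∈ V, (b p - a p) =
      ∑ Q ∈ V.powerset, (-1 : ℝ) ^ Q.card * ((∏ p ∈ Q, a p) * ∏ p ∈ V \ Q, b p) := by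
    rw [Finset.prod_congr rfl fun p _ => (show b p - a p = -a p + b p by ring), Finset.prod_add]
    exact Finset.sum_congr rfl fun Q _ => by rw [Finset.prod_neg]; ring
  rw [h1, h2, ← Finset.sum_sub_distrib, Finset.sum_filter, Finset.mul_sum]
  refine Finset.sum_congr rfl fun Q _ => ?_
  split_ifs with hQ
  · rw [hQ.neg_one_pow]; ring
  · rw [(Nat.not_odd_iff_even.mp hQ).neg_one_pow]; ring

omit [NeZero L] in
/-- `∏_{p∈V}(b_p + a_p) + ∏_{p∈V}(b_p - a_p) = 2 Σ_{Q ⊆ V, |Q| even} ∏_{p∈Q} a_p ∏_{p∈V∖Q} b_p`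
(plumbing). [folklore] -/
private theorem prod_add_add_prod_sub (V : Finset (Plaquette d L)) (a b : Plaquette d L → ℝ) :
    (∏ p ∈ V, (b p + a p)) + ∏ p ∈ V, (b p - a p) =
      2 * ∑ Q ∈ V.powerset.filter (fun Q => Even Q.card), (∏ p ∈ Q, a p) * ∏ p ∈ V \ Q, b p := by
  have h1 : ∏ p ∈ V, (b p + a p) = ∑ Q ∈ V.powerset, (∏ p ∈ Q, a p) * ∏ p ∈ V \ Q, b p := by
    rw [Finset.prod_congr rfl fun p _ => add_comm (b p) (a p), Finset.prod_add]
  have h2 : ∏ p ∈ V, (b p - a p) =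
      ∑ Q ∈ V.powerset, (-1 : ℝ) ^ Q.card * ((∏ p ∈ Q, a p) * ∏ p ∈ V \ Q, b p) := by
    rw [Finset.prod_congr rfl fun p _ => (show b p - a p = -a p + b p by ring), Finset.prod_add]
    exact Finset.sum_congr rfl fun Q _ => by rw [Finset.prod_neg]; ring
  rw [h1, h2, ← Finset.sum_add_distrib, Finset.sum_filter, Finset.mul_sum]
  refine Finset.sum_congr rfl fun Q _ => ?_
  split_ifs with hQ
  · rw [hQ.neg_one_pow]; ring
  · rw [(Nat.not_even_iff_odd.mp hQ).neg_one_pow]; ring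

variable (d L)

/-- **The `Q`-sector term of (A.18)**:
`T_Q = ∫ ∏_{p∉V} f(U_p) ∏_{p∈Q} S_p^{1/2} ∏_{p∈V∖Q} S_p^1 ∏ dU` for `Q ⊆ V`.
[cite: Tomboulis2007Confinement, App. A §5 eq. (A.18)] -/
def tSector (J : ℕ) (c : ℕ → ℝ) (V Q : Finset (Plaquette d L)) : ℝ :=
  ∫ U, (∏ p ∈ Vᶜ, plaqFn J c (plaquetteHolonomy U p.1 p.2.1.1 p.2.1.2)) *
      ((∏ p ∈ Q, sHalf J c (plaquetteHolonomy U p.1 p.2.1.1 p.2.1.2)) *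
        ∏ p ∈ V \ Q, sInt J c (plaquetteHolonomy U p.1 p.2.1.1 p.2.1.2))
    ∂(Measure.pi fun _ : Edge d L => haarProbability SU2)

/-- The sector integrand is continuous (plumbing). [folklore] -/
private theorem continuous_tSector_integrand (J : ℕ) (c : ℕ → ℝ) (V Q : Finset (Plaquette d L)) :
    Continuous fun U : GaugeConfig d L SU2 =>
      (∏ p ∈ Vᶜ, plaqFn J c (plaquetteHolonomy U p.1 p.2.1.1 p.2.1.2)) *
        ((∏ p ∈ Q, sHalf J c (plaquetteHolonomy U p.1 p.2.1.1 p.2.1.2)) *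
          ∏ p ∈ V \ Q, sInt J c (plaquetteHolonomy U p.1 p.2.1.1 p.2.1.2)) :=
  (continuous_finsetProd _ fun p _ => (continuous_plaqFn J c).comp (continuous_hol p)).mul
    ((continuous_finsetProd _ fun p _ => (continuous_sHalf J c).comp (continuous_hol p)).mul
      (continuous_finsetProd _ fun p _ => (continuous_sInt J c).comp (continuous_hol p)))

/-- The untwisted integrand split along the twist set (plumbing). [folklore] -/
private theorem integrand_torusZ (J : ℕ) (c : ℕ → ℝ) (V : Finset (Plaquette d L))
    (U : GaugeConfig d L SU2) :
    ∏ p : Plaquette d L, plaqFn J c (plaquetteHolonomy U p.1 p.2.1.1 p.2.1.2) =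
      (∏ p ∈ Vᶜ, plaqFn J c (plaquetteHolonomy U p.1 p.2.1.1 p.2.1.2)) *
        ∏ p ∈ V, (sInt J c (plaquetteHolonomy U p.1 p.2.1.1 p.2.1.2) +
          sHalf J c (plaquetteHolonomy U p.1 p.2.1.1 p.2.1.2)) := by
  rw [← Finset.prod_mul_prod_compl V, mul_comm]
  simp only [plaqFn_eq_sInt_add_sHalf]

/-- The twisted integrand split along the twist set (plumbing). [folklore] -/
private theorem integrand_torusZtw (J : ℕ) (c : ℕ → ℝ) (V : Finset (Plaquette d L))
    (U : GaugeConfig d L SU2) :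
    ∏ p : Plaquette d L, (if p ∈ V then plaqFnTwist J c (plaquetteHolonomy U p.1 p.2.1.1 p.2.1.2)
        else plaqFn J c (plaquetteHolonomy U p.1 p.2.1.1 p.2.1.2)) =
      (∏ p ∈ Vᶜ, plaqFn J c (plaquetteHolonomy U p.1 p.2.1.1 p.2.1.2)) *
        ∏ p ∈ V, (sInt J c (plaquetteHolonomy U p.1 p.2.1.1 p.2.1.2) -
          sHalf J c (plaquetteHolonomy U p.1 p.2.1.1 p.2.1.2)) := by
  rw [← Finset.prod_mul_prod_compl V, mul_comm]
  congr 1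
  · exact Finset.prod_congr rfl fun p hp => by rw [if_neg (Finset.mem_compl.mp hp)]
  · exact Finset.prod_congr rfl fun p hp => by rw [if_pos hp, plaqFnTwist_eq_sInt_sub_sHalf]

/-- **Tomboulis's expansion of `Z - Z⁻` over the odd twisted sectors** (arXiv:0707.2179 App. A §5,
eqs. (A.17)–(A.18)): for every spin cut-off `J`, all coefficients `c`, every twist set `V` and every
torus, `Z_Λ - Z⁻_Λ(V) = 2 Σ_{Q ⊆ V, |Q| odd} T_Q`.
[cite: Tomboulis2007Confinement, App. A §5 eqs. (A.17)–(A.18)] -/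
theorem torusZ_sub_torusZtw_eq_sum (J : ℕ) (c : ℕ → ℝ) (V : Finset (Plaquette d L)) :
    torusZ d L J c - torusZtw d L J c V =
      2 * ∑ Q ∈ V.powerset.filter (fun Q => Odd Q.card), tSector d L J c V Q := by
  unfold torusZ torusZtw tSector
  simp_rw [integrand_torusZ d L J c V, integrand_torusZtw d L J c V]
  set f : Plaquette d L → GaugeConfig d L SU2 → ℝ := fun p U =>
    plaqFn J c (plaquetteHolonomy U p.1 p.2.1.1 p.2.1.2) with hf
  set a : Plaquette d L → GaugeConfig d L SU2 → ℝ := fun p U =>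
    sHalf J c (plaquetteHolonomy U p.1 p.2.1.1 p.2.1.2) with ha
  set b : Plaquette d L → GaugeConfig d L SU2 → ℝ := fun p U =>
    sInt J c (plaquetteHolonomy U p.1 p.2.1.1 p.2.1.2) with hb
  have hca : ∀ p, Continuous (a p) := fun p => (continuous_sHalf J c).comp (continuous_hol p)
  have hcb : ∀ p, Continuous (b p) := fun p => (continuous_sInt J c).comp (continuous_hol p)
  have hcf : ∀ p, Continuous (f p) := fun p => (continuous_plaqFn J c).comp (continuous_hol p)
  have iA : Integrable (fun U : GaugeConfig d L SU2 => (∏ p ∈ Vᶜ, f p U) * ∏ p ∈ V, (b p U + a p U))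
      (Measure.pi fun _ : Edge d L => haarProbability SU2) :=
    integrable_of_continuous' ((continuous_finsetProd _ fun p _ => hcf p).mul
      (continuous_finsetProd _ fun p _ => (hcb p).add (hca p)))
  have iB : Integrable (fun U : GaugeConfig d L SU2 => (∏ p ∈ Vᶜ, f p U) * ∏ p ∈ V, (b p U - a p U))
      (Measure.pi fun _ : Edge d L => haarProbability SU2) :=
    integrable_of_continuous' ((continuous_finsetProd _ fun p _ => hcf p).mul
      (continuous_finsetProd _ fun p _ => (hcb p).sub (hca p)))
  show ∫ U, (∏ p ∈ Vᶜ, f p U) * ∏ p ∈ V, (b p U + a p U) ∂_ -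
      ∫ U, (∏ p ∈ Vᶜ, f p U) * ∏ p ∈ V, (b p U - a p U) ∂_ =
    2 * ∑ Q ∈ V.powerset.filter (fun Q => Odd Q.card),
      ∫ U, (∏ p ∈ Vᶜ, f p U) * ((∏ p ∈ Q, a p U) * ∏ p ∈ V \ Q, b p U) ∂_
  rw [← integral_sub iA iB]
  have hpt : ∀ U : GaugeConfig d L SU2,
      (∏ p ∈ Vᶜ, f p U) * ∏ p ∈ V, (b p U + a p U) - (∏ p ∈ Vᶜ, f p U) * ∏ p ∈ V, (b p U - a p U) =
        ∑ Q ∈ V.powerset.filter (fun Q => Odd Q.card),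
          2 * ((∏ p ∈ Vᶜ, f p U) * ((∏ p ∈ Q, a p U) * ∏ p ∈ V \ Q, b p U)) := by
    intro U
    rw [← mul_sub, prod_add_sub_prod_sub V (fun p => a p U) (fun p => b p U), Finset.mul_sum,
      Finset.mul_sum]
    exact Finset.sum_congr rfl fun Q _ => by ring
  simp_rw [hpt]
  have iQ : ∀ Q ∈ V.powerset.filter (fun Q => Odd Q.card),
      Integrable (fun U : GaugeConfig d L SU2 =>
        2 * ((∏ p ∈ Vᶜ, f p U) * ((∏ p ∈ Q, a p U) * ∏ p ∈ V \ Q, b p U)))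
        (Measure.pi fun _ : Edge d L => haarProbability SU2) := fun Q _ =>
    (integrable_of_continuous' ((continuous_finsetProd _ fun p _ => hcf p).mul
      ((continuous_finsetProd _ fun p _ => hca p).mul
        (continuous_finsetProd _ fun p _ => hcb p)))).const_mul 2
  rw [integral_finsetSum _ iQ, Finset.mul_sum]
  exact Finset.sum_congr rfl fun Q _ => integral_const_mul _ _

/-- **The even sectors**: `Z_Λ + Z⁻_Λ(V) = 2 Σ_{Q ⊆ V, |Q| even} T_Q` (so `Z⁺ = (Z + Z⁻)/2`, eq. (4.7),
is the sum over the even sectors). [cite: Tomboulis2007Confinement, App. A §5 eqs. (A.17)–(A.18); §4.1 eq. (4.7)] -/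
theorem torusZ_add_torusZtw_eq_sum (J : ℕ) (c : ℕ → ℝ) (V : Finset (Plaquette d L)) :
    torusZ d L J c + torusZtw d L J c V =
      2 * ∑ Q ∈ V.powerset.filter (fun Q => Even Q.card), tSector d L J c V Q := by
  unfold torusZ torusZtw tSector
  simp_rw [integrand_torusZ d L J c V, integrand_torusZtw d L J c V]
  set f : Plaquette d L → GaugeConfig d L SU2 → ℝ := fun p U =>
    plaqFn J c (plaquetteHolonomy U p.1 p.2.1.1 p.2.1.2) with hf
  set a : Plaquette d L → GaugeConfig d L SU2 → ℝ := fun p U =>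
    sHalf J c (plaquetteHolonomy U p.1 p.2.1.1 p.2.1.2) with ha
  set b : Plaquette d L → GaugeConfig d L SU2 → ℝ := fun p U =>
    sInt J c (plaquetteHolonomy U p.1 p.2.1.1 p.2.1.2) with hb
  have hca : ∀ p, Continuous (a p) := fun p => (continuous_sHalf J c).comp (continuous_hol p)
  have hcb : ∀ p, Continuous (b p) := fun p => (continuous_sInt J c).comp (continuous_hol p)
  have hcf : ∀ p, Continuous (f p) := fun p => (continuous_plaqFn J c).comp (continuous_hol p)
  have iA : Integrable (fun U : GaugeConfig d L SU2 => (∏ p ∈ Vᶜ, f p U) * ∏ p ∈ V, (b p U + a p U))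
      (Measure.pi fun _ : Edge d L => haarProbability SU2) :=
    integrable_of_continuous' ((continuous_finsetProd _ fun p _ => hcf p).mul
      (continuous_finsetProd _ fun p _ => (hcb p).add (hca p)))
  have iB : Integrable (fun U : GaugeConfig d L SU2 => (∏ p ∈ Vᶜ, f p U) * ∏ p ∈ V, (b p U - a p U))
      (Measure.pi fun _ : Edge d L => haarProbability SU2) :=
    integrable_of_continuous' ((continuous_finsetProd _ fun p _ => hcf p).mul
      (continuous_finsetProd _ fun p _ => (hcb p).sub (hca p)))
  show ∫ U, (∏ p ∈ Vᶜ, f p U) * ∏ p ∈ V, (b p U + a p U) ∂_ +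
      ∫ U, (∏ p ∈ Vᶜ, f p U) * ∏ p ∈ V, (b p U - a p U) ∂_ =
    2 * ∑ Q ∈ V.powerset.filter (fun Q => Even Q.card),
      ∫ U, (∏ p ∈ Vᶜ, f p U) * ((∏ p ∈ Q, a p U) * ∏ p ∈ V \ Q, b p U) ∂_
  rw [← integral_add iA iB]
  have hpt : ∀ U : GaugeConfig d L SU2,
      (∏ p ∈ Vᶜ, f p U) * ∏ p ∈ V, (b p U + a p U) + (∏ p ∈ Vᶜ, f p U) * ∏ p ∈ V, (b p U - a p U) =
        ∑ Q ∈ V.powerset.filter (fun Q => Even Q.card),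
          2 * ((∏ p ∈ Vᶜ, f p U) * ((∏ p ∈ Q, a p U) * ∏ p ∈ V \ Q, b p U)) := by
    intro U
    rw [← mul_add, prod_add_add_prod_sub V (fun p => a p U) (fun p => b p U), Finset.mul_sum,
      Finset.mul_sum]
    exact Finset.sum_congr rfl fun Q _ => by ring
  simp_rw [hpt]
  have iQ : ∀ Q ∈ V.powerset.filter (fun Q => Even Q.card),
      Integrable (fun U : GaugeConfig d L SU2 =>
        2 * ((∏ p ∈ Vᶜ, f p U) * ((∏ p ∈ Q, a p U) * ∏ p ∈ V \ Q, b p U)))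
        (Measure.pi fun _ : Edge d L => haarProbability SU2) := fun Q _ =>
    (integrable_of_continuous' ((continuous_finsetProd _ fun p _ => hcf p).mul
      ((continuous_finsetProd _ fun p _ => hca p).mul
        (continuous_finsetProd _ fun p _ => hcb p)))).const_mul 2
  rw [integral_finsetSum _ iQ, Finset.mul_sum]
  exact Finset.sum_congr rfl fun Q _ => integral_const_mul _ _

/-- **`Z⁻ ≤ Z` is equivalent to the non-negativity of the odd-sector sum** (the form in which App. A §5
proves Prop. IV.1: "every term in the sum (A.18) is manifestly non-negative by RP").
[cite: Tomboulis2007Confinement, App. A §5 eq. (A.18); Prop. IV.1 eq. (4.6)] -/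
theorem torusZtw_le_torusZ_iff_sum_nonneg (J : ℕ) (c : ℕ → ℝ) (V : Finset (Plaquette d L)) :
    torusZtw d L J c V ≤ torusZ d L J c ↔
      0 ≤ ∑ Q ∈ V.powerset.filter (fun Q => Odd Q.card), tSector d L J c V Q := by
  have h := torusZ_sub_torusZtw_eq_sum d L J c V
  constructor
  · intro hle; linarith
  · intro hnn; linarith

end Tomboulis2007

end Literature.MathematicalPhysics.QuantumFieldTheory

end
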